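import Summits.ValiantsHypothesis.ValiantsHypothesis.Theses.SOSTau
import Literature.Barriers.ValiantsHypothesis.TauRealZeros

/-!
# ValiantsHypothesis / SOSTau — item `ChebyshevCalibration` (stmt-ValiantsHypothesis-18755)

Every admissible SOS-τ constant `c` (a bound `#real zeros ≤ c · Σ |supp gᵢ|` for all weighted sums
of squares `Σ aᵢ gᵢ²`) satisfies `c ≥ 4`: the Chebyshev polynomial `T₃₂ = 2·T₁₆² − 1·1²` is a
two-square representation with support sum `9 + 1 = 10` (`T₁₆` is a polynomial in `X²` of degree
`16`) and `32` distinct real zeros (tree `card_realRoots_chebyshevT`), and `32 ≤ 10 c` forces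
`c ≥ 4`. HONEST FRAMING: calibration lemma of a dormant route (the barrier witness of
`Literature.Barriers.ValiantsHypothesis.TauRealZeros` re-measured); nothing here bears on `VP ≠ VNP`.
-/

-- layout Summits/ValiantsHypothesis/ValiantsHypothesis forces the duplicated namespace component
set_option linter.dupNamespace false

namespace Summit.ValiantsHypothesis.ValiantsHypothesis.Theorems.SOSTau

open Polynomial Polynomial.Chebyshev Finset

/-- The support of `expand R p f` is no larger than that of `f`. [folklore] -/
theorem card_support_expand_le {R : Type*} [CommSemiring R] {p : ℕ} (hp : 0 < p) (f : R[X]) :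
    (expand R p f).support.card ≤ f.support.card := by
  classical
  have hsub : (expand R p f).support ⊆ f.support.image (· * p) := by
    intro n hn
    rw [mem_support_iff, coeff_expand hp] at hn
    split_ifs at hn with hdvd
    · exact mem_image.2 ⟨n / p, mem_support_iff.2 hn, Nat.div_mul_cancel hdvd⟩
    · exact (hn rfl).elim
  exact (card_le_card hsub).trans card_image_le

/-- `T₁₆ ∈ ℝ[X]` has at most `9` monomials (it is `r(X²)` with `deg r ≤ 8`). [folklore] -/
theorem card_support_T_sixteen_le : (T ℝ 16).support.card ≤ 9 := by
  have h16 : T ℝ 16 = expand ℝ 2 ((T ℝ 8).comp (C 2 * X - 1)) := by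
    rw [expand_eq_comp_X_pow, Polynomial.comp_assoc]
    have h2 : (C (2 : ℝ) * X - 1).comp (X ^ 2) = T ℝ 2 := by
      rw [T_two, sub_comp, mul_comp, C_comp, X_comp, one_comp]
      simp [map_ofNat]
    rw [h2, ← T_mul]
    norm_num
  rw [h16]
  refine (card_support_expand_le two_pos _).trans ?_
  refine (card_le_card supp_subset_range_natDegree_succ).trans ?_
  rw [card_range]
  have hdeg : ((T ℝ 8).comp (C 2 * X - 1)).natDegree ≤ 8 := by
    refine natDegree_comp_le.trans ?_
    have h8 : (T ℝ 8).natDegree = 8 := by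
      rw [show (8 : ℤ) = ((8 : ℕ) : ℤ) by norm_num, natDegree_T]; rfl
    have h1 : (C (2 : ℝ) * X - 1).natDegree ≤ 1 := by
      refine (natDegree_sub_le _ _).trans ?_
      rw [natDegree_one, Nat.max_zero]
      exact natDegree_C_mul_le 2 X |>.trans natDegree_X_le
    calc (T ℝ 8).natDegree * (C (2 : ℝ) * X - 1).natDegree ≤ 8 * 1 := by
          rw [h8]; exact Nat.mul_le_mul_left 8 h1
      _ = 8 := rfl
  omega

/-- **Item `ChebyshevCalibration` (stmt-ValiantsHypothesis-18755).** [folklore] -/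
theorem chebyshevCalibration_proof : Theses.SOSTau.ChebyshevCalibration := by
  unfold Theses.SOSTau.ChebyshevCalibration
  intro c hc
  have h := hc 2 ![2, -1] ![T ℝ 16, 1]
  -- the representation is `T₃₂`
  have hsum : (∑ i : Fin 2, Polynomial.C ((![2, -1] : Fin 2 → ℝ) i) * (![T ℝ 16, 1] : Fin 2 → ℝ[X]) i ^ 2)
      = (T ℤ ((2 ^ 5 : ℕ) : ℤ)).map (Int.castRingHom ℝ) := by
    rw [map_T, Fin.sum_univ_two]
    simp only [Matrix.cons_val_zero, Matrix.cons_val_one]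
    have h32 : (((2 ^ 5 : ℕ) : ℤ)) = 2 * 16 := by norm_num
    rw [h32, T_mul, T_two, sub_comp, mul_comp, pow_comp, X_comp, one_comp]
    simp [map_ofNat]
    ring
  rw [hsum, Literature.Barriers.ValiantsHypothesis.card_realRoots_chebyshevT 5, Fin.sum_univ_two] at h
  simp only [Matrix.cons_val_zero, Matrix.cons_val_one] at h
  have h9 := card_support_T_sixteen_le
  have h1 : (1 : ℝ[X]).support.card ≤ 1 := by
    refine (card_le_card supp_subset_range_natDegree_succ).trans ?_
    rw [card_range, natDegree_one]
  have h10 : 2 ^ 5 ≤ c * 10 :=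
    h.trans (Nat.mul_le_mul_left c (Nat.add_le_add h9 h1))
  omega

end Summit.ValiantsHypothesis.ValiantsHypothesis.Theorems.SOSTau
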